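/-
Copyright (c) 2026. All rights reserved.
Released under Apache 2.0 license as described in the file LICENSE.
Authors: HodgeCM publication cell (pub-hodgecm), GR lane, seat GR-2 (`pub-hodgecm-own-hyp34`).
-/
import Literature.NumberTheory.Weil1964.AdelicMetaplecticL2Continuity
import Literature.NumberTheory.Weil1964.ArchSectionThetaMajorants
import HarnessLib

/-!
# `L²`-continuity of `h ↦ ω_ψ(s h) Φ` from an archimedean implementer section / `KAK` data

Topic `NumberTheory/Weil1964`; namespace `Literature.NumberTheory.Weil1964`.  KERNEL ONLY: theorems, no definition, no
named fact, nothing of [Weil1964] or [GelbartRogawski1991] asserted.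

`AdelicMetaplecticL2Continuity.continuous_toL2_omega_comp` derives the strong `L²`-continuity of `h ↦ [ω(s h)Φ]` along a
continuous homomorphism `s : H → Mp_ψ(W_𝐀)ᶜᵒⁿᵗ` from Weil's decay [Weil1964, Chap. III n° 41 Lemme 5] GIVEN the archimedean
covariant family `(W_∞, w0, w1, w2)` of `AdelicMetaplecticThetaMajorants`.  `ArchSectionThetaMajorants` supplies that family
from an archimedean implementer SECTION in a real frame (`hasThetaMajorants_omega_comp_of_section`), along a continuous map
into a group carrying the section (`_of_section_comp`), and from `KAK` implementer data (`_of_kakData`).  This file is the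
`L²` twin of those three wrappers — the same inputs, the conclusion being the `L²(𝐀_Fⁿ, ν)`-continuity of the orbit maps
(the "continuous section" clause of [GelbartRogawski1991, Prop. 3.1.1 p. 455 L1–2] for the `L²` model of `ρ_ψ`):

* `continuous_toL2_omega_comp_of_section`, `continuous_toL2_omega_comp_of_section_comp`,
  **`continuous_toL2_omega_comp_of_kakData`**.

## References
* [Weil1964] A. Weil, Acta Math. 111 (1964) 143–211, Chap. III n° 39 p. 189, n° 41 Lemme 5 p. 192.
* [GelbartRogawski1991] S. Gelbart, J. Rogawski, Invent. Math. 105 (1991) 445–472, §3.1 p. 454 L21–27, Prop. 3.1.1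
  p. 455 L1–2.
* [Folland1989] G. B. Folland, *Harmonic Analysis in Phase Space* (1989), §4.2 (4.23)–(4.24) p. 156.
-/

set_option autoImplicit false

noncomputable section

open scoped Matrix SchwartzMap Topology Classical
open NumberField NumberField.mixedEmbedding MeasureTheory

namespace Literature.NumberTheory.Weil1964

open Literature.NumberTheory.Automorphic Literature.RepresentationTheory.HeisenbergGroup
open Literature.Analysis.SegalBargmann

variable {σ : Type*} [Fintype σ] [DecidableEq σ]
variable {F : Type} [Field F] [NumberField F] {n : ℕ} {T : Matrix (Fin n) (Fin n) (AdeleRing (𝓞 F) F)}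
  {H : Type*} [Group H] [TopologicalSpace H] [IsTopologicalGroup H] [FirstCountableTopology H]
variable [MeasurableSpace (AdeleRing (𝓞 F) F)] [BorelSpace (AdeleRing (𝓞 F) F)]
  (ν : Measure (Fin n → AdeleRing (𝓞 F) F)) [ν.IsAddHaarMeasure]
  (i : piSchwartzBruhat F (Fin n) →ₗ[ℂ] Lp ℂ 2 ν)
  (hi : ∀ Φ : piSchwartzBruhat F (Fin n),
    ((i Φ : Lp ℂ 2 ν) : (Fin n → AdeleRing (𝓞 F) F) → ℂ) =ᵐ[ν] (Φ : (Fin n → AdeleRing (𝓞 F) F) → ℂ))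

omit [DecidableEq σ] in
include hi in
/-- **`L²`-continuity of `h ↦ [ω(s h)Φ]` from an archimedean implementer section** (`N : H → End 𝓢(ℝ^σ)` in a real frame
`e`, implementing the Folland-coordinate phase map of `π(s h)`; `(n0)`–`(n2)` as in
`hasThetaMajorants_omega_comp_of_section`). [cite: Weil1964, Chap. III n° 41 Lemme 5 p. 192, n° 39 p. 189;
GelbartRogawski1991, Prop. 3.1.1 p. 455 L1–2; Folland1989, §4.2 (4.24) p. 156] -/
theorem continuous_toL2_omega_comp_of_section (hT : IsUnit T) (s : H →* adelicMpCont F (Fin n) T)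
    (hs : Continuous s) (e : (Fin n → mixedSpace F) ≃L[ℝ] (σ → ℝ)) (hT' : IsUnit (archMat F (Fin n) T))
    (N : H → ((SchwartzMap (σ → ℝ) ℂ) →L[ℂ] SchwartzMap (σ → ℝ) ℂ)) (n0 : ∀ h, N h ≠ 0) (n1 : ∀ f : SchwartzMap (σ → ℝ) ℂ, Continuous fun h => N h f)
    (n2 : ∀ (h : H) (p q : σ → ℝ) (f : SchwartzMap (σ → ℝ) ℂ), N h (rhoS p q f) =
      rhoS (archPhaseMap T e hT' (adelicMpCont.proj F (Fin n) T (s h)) (p, q)).1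
        (archPhaseMap T e hT' (adelicMpCont.proj F (Fin n) T (s h)) (p, q)).2 (N h f))
    (Φ : piSchwartzBruhat F (Fin n)) :
    Continuous fun h => i (adelicMpCont.omega F (Fin n) T (s h) Φ) :=
  continuous_toL2_omega_comp ν hT s hs (fun h => carrierConj e (N h)) (fun h => carrierConj_ne_zero e (n0 h))
    (fun Φ => continuous_carrierConj_apply e n1 Φ)
    (fun h a w Φ => arch_implements_of_covariant_rhoSD_clm T e hT' (adelicMpCont.proj F (Fin n) T (s h))
      (carrierConj e (N h)) (fun p q Ψ => carrierConj_rhoSD e (n2 h) p q Ψ) a w Φ) i hi Φ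

variable {G : Type*} [Monoid G] [TopologicalSpace G] {K : Type*} [TopologicalSpace K] {P : Type*} [TopologicalSpace P]

omit [DecidableEq σ] [Monoid G] in
include hi in
/-- **… along a continuous map into a group carrying the section** (`N₀ : G → End 𝓢(ℝ^σ)` implementing `γ : G → PhaseMap σ`,
`ϖ : H → G` continuous, dictionary `archPhaseMap T e (π(s h)) = γ (ϖ h)`). [cite: Weil1964, Chap. III n° 41 Lemme 5 p. 192;
GelbartRogawski1991, Prop. 3.1.1 p. 455 L1–2] -/
theorem continuous_toL2_omega_comp_of_section_comp (hT : IsUnit T) (s : H →* adelicMpCont F (Fin n) T)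
    (hs : Continuous s) (e : (Fin n → mixedSpace F) ≃L[ℝ] (σ → ℝ)) (hT' : IsUnit (archMat F (Fin n) T))
    {γ : G → PhaseMap σ} (N₀ : G → ((SchwartzMap (σ → ℝ) ℂ) →L[ℂ] SchwartzMap (σ → ℝ) ℂ)) (n0 : ∀ g, N₀ g ≠ 0)
    (n1 : ∀ f : SchwartzMap (σ → ℝ) ℂ, Continuous fun g => N₀ g f) (n2 : ∀ g, IsImplementerS (γ g) (N₀ g))
    (ϖ : H → G) (hϖ : Continuous ϖ)
    (hγ : ∀ h, archPhaseMap T e hT' (adelicMpCont.proj F (Fin n) T (s h)) = γ (ϖ h))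
    (Φ : piSchwartzBruhat F (Fin n)) :
    Continuous fun h => i (adelicMpCont.omega F (Fin n) T (s h) Φ) :=
  continuous_toL2_omega_comp_of_section ν i hi hT s hs e hT' (fun h => N₀ (ϖ h)) (fun h => n0 (ϖ h))
    (fun f => (n1 f).comp hϖ) (fun h p q f => by
      rw [hγ h]
      exact (n2 (ϖ h)).1 p q f) Φ

include hi in
/-- **`L²`-continuity of `h ↦ [ω(s h)Φ]` from `KAK` implementer data**: for `T` invertible with invertible archimedean part,
a continuous homomorphism `s : H → Mp_ψ(W_𝐀)ᶜᵒⁿᵗ` (`H` first countable), a real frame `e`, a phase-space action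
`γ : G → PhaseMap σ` with `KAK` implementer data and a continuous `ϖ : H → G` with `archPhaseMap T e (π(s h)) = γ (ϖ h)`:
every orbit map `h ↦ [ω(s h) Φ]` is continuous in `L²(𝐀_Fⁿ, ν)` (archimedean family = `carrierConj e ∘ vacSection γ ∘ ϖ`).
[cite: Weil1964, Chap. III n° 41 Lemme 5 p. 192, n° 39 p. 189; GelbartRogawski1991, Prop. 3.1.1 p. 455 L1–2;
Folland1989, §4.2 (4.23)–(4.24) p. 156] -/
theorem continuous_toL2_omega_comp_of_kakData (hT : IsUnit T) (s : H →* adelicMpCont F (Fin n) T)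
    (hs : Continuous s) (e : (Fin n → mixedSpace F) ≃L[ℝ] (σ → ℝ)) (hT' : IsUnit (archMat F (Fin n) T))
    {γ : G → PhaseMap σ} {κ : K → G} {a : P → G} {WK : K → ((SchwartzMap (σ → ℝ) ℂ) →L[ℂ] SchwartzMap (σ → ℝ) ℂ)}
    {WA : P → ((SchwartzMap (σ → ℝ) ℂ) →L[ℂ] SchwartzMap (σ → ℝ) ℂ)} (Dk : KAKImplementerData γ κ a WK WA) (ϖ : H → G) (hϖ : Continuous ϖ)
    (hγ : ∀ h, archPhaseMap T e hT' (adelicMpCont.proj F (Fin n) T (s h)) = γ (ϖ h))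
    (Φ : piSchwartzBruhat F (Fin n)) :
    Continuous fun h => i (adelicMpCont.omega F (Fin n) T (s h) Φ) :=
  continuous_toL2_omega_comp_of_section_comp ν i hi hT s hs e hT' (vacSection γ) Dk.vacSection_ne_zero
    Dk.continuous_apply_vacSection Dk.isImplementerS_vacSection ϖ hϖ hγ Φ

end Literature.NumberTheory.Weil1964

end
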